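import Summits.BirchSwinnertonDyer.BirchSwinnertonDyer.Theorems.SignedBaseChangeAnticyclotomicEisensteinDivisibilityAdmdefLayerZeroDictionary
import Literature.NumberTheory.EllipticCurves.AnticyclotomicSignedCompactSelmer
import Literature.NumberTheory.EllipticCurves.IwasawaSelmerProofs
import HarnessLib

/-!
# Line `admdef` (crux `AnticyclotomicEisensteinDivisibility`, stmt-BirchSwinnertonDyer-20727), rigidity road: the EASY HALF of the `±` control (CTRL) at
# layer 0 HOLDS — the Kummer condition at `v ∣ p` implies the signed condition `ℋ^ε_{0,v}[p]`

LEAD seat bsd-line-sbc-p1 (gen 28), `--supports stmt-BirchSwinnertonDyer-20727` (helper; OFF the v23 composition path).  The rigidity-road files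
`…AdmdefHowardVanishing` ∕ `…AdmdefHowardRigidityRoot(AllRamified)` carry the hypothesis
  (CTRL) `T X ∈ condAboveTorsion (W_K) p κ v (sgn ε) 0 1 ⟹ X ∈ selmerLocalKer (W_K) K_v p` for every `X ∈ H¹(K, E[p])`, `v ∣ p`
(`T` = the transport `H¹(K, E[p]) → H¹(Γ_{K_0}, E[p^1])` of `…AdmdefLayerZeroDictionary`) — the hard half «`ℋ^±_{0,v}[p] ⊆ E(K_v)/p`» of B.-D. Kim's
layer-0 control `ℋ^±_{0,v}[p^m] = E(K_v) ⊗ ℤ/p^m` (Hatley–Lei–Vigni 2022, proof of Lemma 3.7: both sides free of rank one over `ℤ/p^m` and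
«`E(K_v)/p^m E(K_v)` is contained in `ℋ^±_{0,v}[p^m]`»).  THIS FILE proves the EASY half in exactly the currency of (CTRL):
`resH1Hom_layerZero_mem_condAboveTorsion_of_mem_selmerLocalKer` — **`X ∈ selmerLocalKer (W_K) K_v p ⟹ T X ∈ condAboveTorsion (W_K) p κ v (sgn ε) 0 1`**
(for every sign `ε` and every finite place `v`; no hypothesis on `v`, `p`, `E`).  So (CTRL) is precisely the statement that this inclusion is an equality —
a consistency witness for the hypothesis and for the typed carriers (`AcSigned.condAboveTorsion`, `Kobayashi2003.localKummerOverOfEmb`,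
`AcSigned.signedLocalPointsInfty`).  Proof: a cocycle `ψ` of `X` with `ψ(τ|_{K̄}) = τ a − a` on `Γ_{K_v}` (`a ∈ E(K̄_v)`, the Kummer condition); the
class `θ_{0,1}(T X) ∈ H¹(K_∞, E[p^∞])` is represented by the same cocycle, its conjugates by `σ ∈ Γ_K = Γ_{K_0}` are itself (inner automorphisms,
tree `conjH1_of_mem_holds`), and on `Gal(K̄_v ∕ K_∞·K_v)` it is the Kummer cocycle of `a` with `p • a ∈ E(K_v) = E(K_0·K_v) ≤ E^ε(K_∞·K_v)`
(`τ(p a) − p a = p ψ(τ) = 0`; tree `localLayerPointsOfEmb_zero_le_signedLocalPointsInfty`).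

HONEST FRAMING: theorems only (no definition, no named fact, no `sorry`); the HARD half (CTRL) is NOT proved here; nothing about the crux, the anchors
(K1) or BSD is asserted.

References: [cite: HatleyLeiVigni2022, Lemma 3.7 (proof), (3.1), Remark 3.1, Def. 3.4] [cite: BDKim2013, Def. 3.3, Def. 3.5 (pp. 193–194)]
[cite: Kobayashi2003, Def. 1.1] [cite: SerreLocalFields1979, VII.§5 Prop. 3].
-/

-- D-0017: single-problem summit, the namespace repeats the problem name by design.
set_option linter.dupNamespace false
set_option autoImplicit false

noncomputable section

open scoped Classical NumberField Pointwise

namespace Summit.BirchSwinnertonDyer.BirchSwinnertonDyer.Theorems.SignedBaseChangeAcDivAdmdefSignedControlEasy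

open WeierstrassCurve NumberField IsDedekindDomain Field
open Literature.NumberTheory.EllipticCurves Literature.NumberTheory.GaloisRepresentations
open Literature.NumberTheory.EllipticCurves.AcSigned Literature.NumberTheory.EllipticCurves.Kobayashi2003
open Summit.BirchSwinnertonDyer.BirchSwinnertonDyer.Theorems.AdditiveKoly
open Summit.BirchSwinnertonDyer.BirchSwinnertonDyer.Theorems.SignedBaseChangeAcDivAdmdefCoreRootOfSeenAnchor
open Summit.BirchSwinnertonDyer.BirchSwinnertonDyer.Theorems.SignedBaseChangeAcDivAdmdefLayerZeroDictionary

universe u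

variable {K : Type} [Field K] [NumberField K] (W : WeierstrassCurve ℚ) {p : ℕ} [Fact p.Prime] (κ : ZpExtension K p)

/-- **`θ_{0,1} ∘ T` on an explicit cocycle**: the class `θ_{0,1}(T [ψ]) ∈ H¹(K_∞, E[p^∞])` is represented by the cocycle `h ↦ ψ(h)` on `Gal(K̄/K_∞)`
(coefficients `E[(p^1 : ℕ)] ↪ E[p^1] ↪ E[p^∞]`). [cite: SerreGaloisCohomology1997, I §2.4] -/
theorem toInfty_resH1Hom_layerZero_oneCocycleClass
    (ψ : contOneCocycles (discreteTopRep (absoluteGaloisGroup K) (geomTorsion (W.baseChange K) ((p ^ 1 : ℕ) : ℤ)))) :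
    toInfty (W.baseChange K) p κ 0 1
        (resH1Hom (Literature.NumberTheory.EllipticCurves.subgroupIncl (κ.layerSubgroup 0))
          (AddSubgroup.inclusion (geomTorsion_natCast_pow_one W (K := K) (p := p)).le) (fun _ _ ↦ rfl) (oneCocycleClass _ ψ)) =
      oneCocycleClass (discreteTopRep κ.kerSubgroup ((W.baseChange K).geomPrimaryTorsion p))
        (contOneCocycles.pullback (subgroupInclusion (κ.kerSubgroup_le_layerSubgroup 0))
          (resHomOfEquivariant (subgroupInclusion (κ.kerSubgroup_le_layerSubgroup 0))
            (AddSubgroup.inclusion (geomTorsion_zpow_le_geomPrimaryTorsion (W.baseChange K) p 1)) (fun _ _ ↦ rfl))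
          (contOneCocycles.pullback (Literature.NumberTheory.EllipticCurves.subgroupIncl (κ.layerSubgroup 0))
            (resHomOfEquivariant (Literature.NumberTheory.EllipticCurves.subgroupIncl (κ.layerSubgroup 0))
              (AddSubgroup.inclusion (geomTorsion_natCast_pow_one W (K := K) (p := p)).le) (fun _ _ ↦ rfl)) ψ)) := by
  rw [resH1Hom_layerZero_oneCocycleClass]
  change ContinuousCohomology.map _ (resHomOfEquivariant _ _ _) 1 (oneCocycleClass _ _) = _
  rw [map_oneCocycleClass]

/-- **The EASY half of the layer-0 `±` control, in the currency of (CTRL): Kummer at `v` ⟹ signed at `v`.**  For every `X ∈ H¹(K, E[p])` satisfying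
the Kummer condition at the completion `K_v` (`selmerLocalKer`: `X` dies in `H¹(K_v, E)`), its transport `T X ∈ H¹(Γ_{K_0}, E[p])` satisfies the
layer-0 signed condition `condAboveTorsion (W_K) p κ v (sgn ε) 0 1` (Hatley–Lei–Vigni's `ℋ^ε_{0,v}[p]`-condition at every place of `K_0 = K` above `v`),
for both signs — «`E(K_v)/p^m E(K_v)` is contained in `ℋ^±_{0,v}[p^m]`» (proof of HLV Lemma 3.7) for the tree's carriers.
[cite: HatleyLeiVigni2022, Lemma 3.7 (proof), (3.1), Def. 3.4] [cite: BDKim2013, Def. 3.3, Def. 3.5 (pp. 193–194)] [cite: Kobayashi2003, Def. 1.1] -/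
theorem resH1Hom_layerZero_mem_condAboveTorsion_of_mem_selmerLocalKer (v : HeightOneSpectrum (𝓞 K)) (ε : ℤˣ) (X : Vp W K p)
    (hX : X ∈ selmerLocalKer (W.baseChange K) (v.adicCompletion K) ((p ^ 1 : ℕ) : ℤ)) :
    resH1Hom (Literature.NumberTheory.EllipticCurves.subgroupIncl (κ.layerSubgroup 0))
        (AddSubgroup.inclusion (geomTorsion_natCast_pow_one W (K := K) (p := p)).le) (fun _ _ ↦ rfl) X ∈
      condAboveTorsion (W.baseChange K) p κ v (.sgn ε) 0 1 := by
  obtain ⟨ψ, rfl⟩ := oneCocycleClass_surjective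
    (discreteTopRep (absoluteGaloisGroup K) (geomTorsion (W.baseChange K) ((p ^ 1 : ℕ) : ℤ))) X
  -- the Kummer condition: `ψ(τ|_{K̄}) = τ a − a` on `Γ_{K_v}`
  obtain ⟨a, ha⟩ := (oneCocycleClass_mem_resKer_iff (resGal (K := K) (v.adicCompletion K))
    ((pointsMap (W.baseChange K) (v.adicCompletion K)).comp (geomTorsion (W.baseChange K) ((p ^ 1 : ℕ) : ℤ)).subtype) _ ψ).mp hX
  rw [mem_condAboveTorsion_iff, mem_condAbove_sgn_iff]
  intro σ
  -- conjugation by `σ ∈ Γ_K = Γ_{K_0}` is the identity on `H¹(Γ_{K_0}, ·)`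
  rw [← toInfty_conjH1, Literature.NumberTheory.EllipticCurves.conjH1_of_mem_holds (κ.layerSubgroup 0)
    (geomTorsion (W.baseChange K) ((p : ℤ) ^ 1)) (by rw [ZpExtension.layerSubgroup_zero]; exact Subgroup.mem_top σ), AddMonoidHom.id_apply,
    toInfty_resH1Hom_layerZero_oneCocycleClass]
  -- the signed Kummer condition at the chosen place above `v`, witnessed by `a` and `k = 1`
  refine (mem_localKummerOverOfEmb_iff _ _).mpr ⟨_, a, 1, rfl, ?_, fun τ ↦ ?_⟩
  · -- `p • a ∈ E(K_v) ≤ E^ε(K_∞·K_v)`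
    apply localLayerPointsOfEmb_zero_le_signedLocalPointsInfty
    rw [mem_localLayerPointsOfEmb_zero_iff]
    intro τ
    have h1 : τ • a = a + pointsMap (W.baseChange K) (v.adicCompletion K)
        ((ψ.1 (resGal (K := K) (v.adicCompletion K) τ) : geomTorsion (W.baseChange K) ((p ^ 1 : ℕ) : ℤ)) :
          (W.baseChange K).geomPoints) := by
      rw [add_comm, ← sub_eq_iff_eq_add]
      exact (ha τ).symm
    have h0 : (p ^ 1) • pointsMap (W.baseChange K) (v.adicCompletion K)
        ((ψ.1 (resGal (K := K) (v.adicCompletion K) τ) : geomTorsion (W.baseChange K) ((p ^ 1 : ℕ) : ℤ)) :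
          (W.baseChange K).geomPoints) = 0 := by
      rw [← map_nsmul, ← natCast_zsmul,
        (mem_geomTorsion_iff _ _ _).mp (ψ.1 (resGal (K := K) (v.adicCompletion K) τ) :
          geomTorsion (W.baseChange K) ((p ^ 1 : ℕ) : ℤ)).2, map_zero]
    rw [smul_comm, h1, nsmul_add, h0, add_zero]
  · -- the cocycle identity on `Gal(K̄_v / K_∞·K_v)`
    have h := ha (τ : absoluteGaloisGroup (v.adicCompletion K))
    exact h

end Summit.BirchSwinnertonDyer.BirchSwinnertonDyer.Theorems.SignedBaseChangeAcDivAdmdefSignedControlEasy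

end
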